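import Literature.Analysis.FluidPDE.AxisymNoSwirlScalarEq
import Literature.Analysis.FluidPDE.VorticityCalculus
import Literature.Analysis.FluidPDE.ConstantinDirectionDissipationCalculus
import HarnessLib

/-!
# The vortex-stretching density vanishes identically on purely azimuthal fields

For a velocity field of the form `u(y) = g(y) · J y`, `J y = (−y₁, y₀, 0)` the infinitesimal rotation about
the `z`-axis (`rotGen`) and `g : ℝ³ → ℝ` ANY differentiable scalar (axisymmetric or not), the vorticity
`ω = curl u = ∇g × Jy + 2g e_z` is orthogonal to `J y`, and the stretching density
`ω · (ω·∇)u = ⟪ω, Du(y) ω⟫ = ⟪∇g, ω⟫ ⟪ω, Jy⟫ + g ⟪ω, Jω⟫` vanishes IDENTICALLY. In particular every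
«axisymmetric purely azimuthal» datum `u = u_θ(r,z) e_θ` (= `(u_θ/r) · J`) has zero vortex stretching
`∫ ω·(ω·∇)u = 0`, whatever lower bound a text may assert for it (the vorticity of an axisymmetric
swirling field is eq. (2.64) of Majda–Bertozzi 2002, §2.3.3, PDF p. 58: `ω = −v^θ_{x₃} e_r + ω^θ e_θ + r⁻¹(r v^θ)_r e₃`
with `ω^θ = v^r_{x₃} − v³_r = 0` when `v^r = v³ = 0`, so `ω` is meridional while `(ω·∇)u` is azimuthal).
Theorems only (no definitions, no named facts).

## References
[cite: MajdaBertozziCUP2002, §2.3.3 eq. (2.63)–(2.64) (PDF p. 58)]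
-/

noncomputable section

open MeasureTheory
open scoped RealInnerProductSpace

namespace Literature.Analysis.FluidPDE

/-- `curl J = 2 e_z` for the infinitesimal rotation `J y = (−y₁, y₀, 0)`: the first two components vanish
and the third is `2`. [cite: MajdaBertozziCUP2002, §2.3.3 eq. (2.63)–(2.64) (PDF p. 58)] -/
theorem curl_rotGen_apply (x : (EuclideanSpace ℝ (Fin 3))) :
    curl rotGen x 0 = 0 ∧ curl rotGen x 1 = 0 ∧ curl rotGen x 2 = 2 := by
  rw [curl_eq_curlCLM, fderiv_rotGen]
  obtain ⟨h0, h1, h2⟩ := curlCLM_apply_coord rotGenL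
  refine ⟨?_, ?_, ?_⟩
  · rw [h0]; simp [EuclideanSpace.basisFun_apply, rotGen]
  · rw [h1]; simp [EuclideanSpace.basisFun_apply, rotGen]
  · rw [h2]; simp [EuclideanSpace.basisFun_apply, rotGen]; norm_num

/-- **The vorticity of an azimuthal field is orthogonal to the azimuthal direction**:
`⟪J x, curl (g·J)(x)⟫ = 0` for every scalar `g` differentiable at `x` (`curl (gJ) = g curl J + ∇g × J`,
`curl J = 2e_z ⊥ Jx`, `∇g × Jx ⊥ Jx`). [cite: MajdaBertozziCUP2002, §2.3.3 eq. (2.63)–(2.64) (PDF p. 58)] -/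
theorem inner_rotGen_curl_smul_rotGen_eq_zero {g : (EuclideanSpace ℝ (Fin 3)) → ℝ} {x : (EuclideanSpace ℝ (Fin 3))} (hg : DifferentiableAt ℝ g x) :
    ⟪rotGen x, curl (fun y => g y • rotGen y) x⟫ = 0 := by
  rw [curl_smul hg (hasFDerivAt_rotGen x).differentiableAt, inner_add_right, inner_smul_right,
    inner_rotGen_left, inner_rotGen_left]
  obtain ⟨c0, c1, -⟩ := curl_rotGen_apply x
  obtain ⟨h0, h1, -⟩ := curlCLM_apply_coord ((fderiv ℝ g x).smulRight (rotGen x))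
  rw [c0, c1, h0, h1]
  simp [ContinuousLinearMap.smulRight_apply, rotGen]
  ring

/-- **The vortex-stretching density vanishes identically on azimuthal fields**: for `u = g·J` with `g`
differentiable at `x`, `⟪curl u(x), Du(x)(curl u(x))⟫ = 0` — by the Leibniz rule
`Du(x) h = (Dg(x) h) Jx + g(x) Jh`, the orthogonality `curl u ⊥ Jx` and `⟪h, Jh⟫ = 0`.
[cite: MajdaBertozziCUP2002, §2.3.3 eq. (2.63)–(2.64) (PDF p. 58)] -/
theorem inner_curl_fderiv_curl_smul_rotGen_eq_zero {g : (EuclideanSpace ℝ (Fin 3)) → ℝ} {x : (EuclideanSpace ℝ (Fin 3))} (hg : DifferentiableAt ℝ g x) :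
    ⟪curl (fun y => g y • rotGen y) x,
      fderiv ℝ (fun y => g y • rotGen y) x (curl (fun y => g y • rotGen y) x)⟫ = 0 := by
  rw [fderiv_smul_rotGen_apply hg, inner_add_right, inner_smul_right, inner_smul_right,
    real_inner_comm (rotGen x), inner_rotGen_curl_smul_rotGen_eq_zero hg,
    real_inner_comm (rotGen _), inner_rotGen_self]
  simp

/-- **Zero total vortex stretching for azimuthal data**: `∫ ⟪curl u, Du (curl u)⟫ = 0` for `u = g·J`,
`g` differentiable — e.g. every axisymmetric purely azimuthal field `u_θ(r,z) e_θ` with `u_θ/r`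
differentiable. [cite: MajdaBertozziCUP2002, §2.3.3 eq. (2.63)–(2.64) (PDF p. 58)] -/
theorem integral_inner_curl_fderiv_curl_smul_rotGen_eq_zero {g : (EuclideanSpace ℝ (Fin 3)) → ℝ} (hg : Differentiable ℝ g) :
    ∫ x, ⟪curl (fun y => g y • rotGen y) x,
      fderiv ℝ (fun y => g y • rotGen y) x (curl (fun y => g y • rotGen y) x)⟫ = 0 := by
  simp [inner_curl_fderiv_curl_smul_rotGen_eq_zero (hg _)]

end Literature.Analysis.FluidPDE

end
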